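import Literature.MathematicalPhysics.QuantumFieldTheory.Balaban1983to89.B7Eq47AveragedBondVsStraight
import Literature.MathematicalPhysics.QuantumFieldTheory.Balaban1983to89.B8Ineq159StencilsNearFlat

/-!
# `Balaban1983to89.B9Thm31NearFlatTransportersZd` — [Balaban1985Averaging] (42)–(43) pp. 23–24, Prop. 2 (52)–(54) p. 26, (78)–(80) p. 30 ∕ [Balaban1985BackgroundPropagators]
# (3.19) p. 393, p. 416 («U = e^{iηA} with A small»): THE AVERAGED TOWER TRANSPORTERS OF A NEAR-FLAT SMALL-PLAQUETTE BACKGROUND ARE CLOSE TO `1`, LINEARLY IN THE BLOCK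
# SCALE — `‖Ū₀ⁱ(Γ_{blockMap L w, w}) − 1‖ ≤ dL·(C₁α₀(Lⁱ∕L^k)² + Lⁱδ)` for `‖U₀(b) − 1‖ ≤ δ` on all bonds and `pdev U₀ < α₀L^{−2k}` — and the resulting SCALE-FREE bound
# `a_j(Lᵈ)^{−j}(Σ_{i<j}ε′_i)² ≤ Ad²L²(C₁α₀ + θ′)²` for `δ = θ′η`, `L^{−k} ≤ η`, `ηLʲ ≤ 1`, weights `a_j ≤ Aη⁻²L^{(d−2)j}`: the displayed transporter hypothesis of this seat's
# `B9Thm31NearFlatCoerciveCubeZd.coercive_near_flat_cubeMember_of_norm` DISCHARGED from the background's own smallness (`C₁ = 256(d+1)(d+4)`)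

statement-level skeleton of published theorems with citation tags; proofs where landed; nothing here is a claim about the
Yang–Mills mass gap

`[Balaban1985Averaging]` ("B7", CMP **98** (1985) 17–51) (42)–(43) pp. 23–24 (the `j`-fold average `Ūʲ`), Prop. 2 (52)–(54) p. 26 (averages of a small-plaquette configuration stay
small-plaquette), (78)–(80) p. 30 (the block transporters `R(Ū(Γ_{y,x}))`); `[Balaban1985BackgroundPropagators]` ("B9") (3.19) p. 393 (`Q′_j(U) = Q′(Ūʲ⁻¹)⋯Q′(U)`), p. 416.  The two
inputs BY NAME: the pub-balaban NE9 chain's `B7Eq47AveragedBondVsStraight.norm_avgIter_sub_straight_le` (`‖Ūʲ(z,κ) − U(Lʲz; seg_κ(Lʲ))‖ ≤ 256(d+1)(d+4)α₀(Lʲ∕L^k)²` — the area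
law, UNIFORM in the number of levels) and `B9Eq315QLipschitz.norm_hol_sub_one_le` (`‖U(Γ) − 1‖ ≤ |Γ|δ`).  PDF held: `paper:balaban1985-cmp99-background-propagators` p. 416
(re-read 2026-08-28); [B7]'s displays via the cited files' headers.

CITATION HEADER (lean-in-tree rule).  Cell `pub-ymgap` (YM Track A, D-0062 ∕ D-0149), node N06 = [B9], width seat `pub-ymgap-dag-n06-w4` (g5), CLAIM-8 ∕ INTENT-8.  WHY: the near-flat
member-uniform coercivity of `Δ′_a` (`B9Thm31NearFlatCoerciveCubeZd`) displays `‖Ū₀ⁱ(Γ_{blockMap L w, w}) − 1‖ ≤ ε′_i` and `a_j(Lᵈ)^{−j}(Σ_{i<j}ε′_i)² ≤ κ′`; with the crude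
iteration `(8(d+1)L)^i·δ` of `B7Eq43AveragedSmallness` the constant `κ′` would grow with the level — the area law of (52)–(54) is what keeps it scale-free.  Other inputs:
`B7Prop2Explicit` (`avgIter_mem`, `avgClosed_unitaryUnits`, `unitaryUnits_le_U1`, `hol_mem_of`, `pdev`, `C0`, `c2'`), `B7Prop1Explicit` (`seg`, `length_seg`, `treeWord`,
`length_treeWord`, `axialFn`), `B8Eq119TwistedAxial.bgT`, dag-n05-w3's `B8Ineq159StencilsNearFlat.l1_sub_blockBase_blockMap_le` (and the shape of its
`B8Ineq159TowerNearFlat.norm_bgT_sub_one_le`, here per level).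

WHAT IS PROVED (kernel, 0 sorry; theorems only — no `def`, `instance`, `notation`).
* §1 `bgT_pair_mem_of` (the tower transporter lies in any subgroup containing the averaged bond variables), ★ `norm_bgT_pair_sub_one_le_of_level` (per level `i`:
  `Ū₀ⁱ ∈ U1`, `‖Ū₀ⁱ − 1‖ ≤ ε ⟹ ‖Ū₀ⁱ(Γ_{blockMap L w, w}) − 1‖ ≤ dL·ε`).
* §2 ★★ `norm_avgIter_sub_one_le_of_straight` (`‖Ūʲ(z,κ) − 1‖ ≤ 256(d+1)(d+4)α₀(Lʲ∕L^k)² + Lʲ·δ` for `j ≤ k` on the class (52) with `δ`-close bonds),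
  ★★ `norm_bgT_pair_sub_one_le` (`‖Ū₀ⁱ(Γ_{blockMap L w, w}) − 1‖ ≤ dL·(256(d+1)(d+4)α₀(Lⁱ∕L^k)² + Lⁱδ)`, `i ≤ k`), `bgT_mem_unitaryUnits_of_pdev` (they are unitary).
* §3 ★★ `sum_eps_sq_weight_le` (the SCALE-FREE `κ′`: with `δ = θ′η`, `L^{−k} ≤ η`, `ηLʲ ≤ 1` for `j ≤ m`, and `a_jη²(Lʲ)² ≤ A(Lʲ)^d`:
  `a_j·(Lᵈ)^{−j}·(Σ_{i<j} dL(256(d+1)(d+4)α₀(Lⁱ∕L^k)² + Lⁱθ′η))² ≤ Ad²L²(256(d+1)(d+4)α₀ + θ′)²` for every `j ≤ m`).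

HONEST SCOPE.  (i) Elementary telescoping + the cited area law; constants crude but scale-free.  (ii) The hypotheses `‖U₀(b) − 1‖ ≤ θ′η` on ALL bonds of `ℤᵈ` and `pdev U₀ < α₀L^{−2k}`
are print's small-field class AFTER the block gauge fixing of [B9] Sect. B — the gauge fixing itself and the gauge covariance of the form are NOT here.  Count-neutral helper
(`--supports` the K1 item of record); N05 ∕ N06 NOT discharged; K1 NOT closed; one finite `𝕋⁴` programme at fixed `ε`, Bałaban as printed; R4 closes only the conditional
finite-`𝕋⁴` rung `BalabanLadder.UV` — nothing continuum ∕ ℝ⁴ ∕ OS ∕ mass gap ∕ Clay.  Unit `pub-ymgap-dag-n06-w4` (g5), 2026-08-28.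
-/

noncomputable section

namespace Literature.MathematicalPhysics.QuantumFieldTheory.Balaban1983to89.B9Thm31NearFlatTransportersZd

open B7Prop1Explicit
open B7Prop2Explicit (unitaryUnits avgIter pdev C0 c2' AvgClosed avgIter_mem avgClosed_unitaryUnits unitaryUnits_le_U1 hol_mem_of)
open B8Eq119TwistedAxial (bgT)
open Literature.MathematicalPhysics.QuantumLattice (blockMap blockBase)
open B7Eq47AveragedBondVsStraight (norm_avgIter_sub_straight_le)
open B9Eq315QLipschitz (norm_hol_sub_one_le)
open B8Ineq159StencilsNearFlat (l1_sub_blockBase_blockMap_le)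

-- `Site` alone could resolve to the torus sites of `Setup.lean`; re-export the `ℤ^d` sites of `B7Prop1Explicit`.
export B7Prop1Explicit (Site)

variable {d : ℕ} {𝔸 : Type*} [CStarAlgebra 𝔸]

/-! ## §1  One tower transporter, per level -/

section PerLevel

variable {L : ℕ} {U₀ : Site d → Fin d → 𝔸ˣ}

/-- the tower transporter `Ū₀ⁱ(Γ_{y,x})` lies in any subgroup containing the bond variables of `Ū₀ⁱ`. [cite: Balaban1985Averaging, (78)–(80) p.30 (bookkeeping)] -/
theorem bgT_pair_mem_of {S : Subgroup 𝔸ˣ} {i : ℕ} (h : ∀ (x : Site d) (κ : Fin d), avgIter L U₀ i x κ ∈ S) (y x : Site d) : bgT L U₀ i y x ∈ S := by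
  unfold bgT axialFn
  exact hol_mem_of h _ _

variable [Nontrivial 𝔸]

/-- ★ **PER LEVEL**: if the averaged background `Ū₀ⁱ` is unit-bounded and `ε`-close to `1` on every bond, then `‖Ū₀ⁱ(Γ_{blockMap L w, w}) − 1‖ ≤ dL·ε` (the tree contour from the
base of the `L`-block of `w` to `w` has at most `dL` bonds; the shape of dag-n05-w3's `B8Ineq159TowerNearFlat.norm_bgT_sub_one_le`, one level at a time).
[cite: Balaban1985Averaging, (78)–(80) p.30, (43) p.24; Balaban1985RegularSpaces, (1.29) p.81] -/
theorem norm_bgT_pair_sub_one_le_of_level (hL : 1 ≤ L) {i : ℕ} {ε : ℝ} (hε0 : 0 ≤ ε)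
    (hUi : ∀ (x : Site d) (κ : Fin d), avgIter L U₀ i x κ ∈ U1 𝔸) (hεi : ∀ (x : Site d) (κ : Fin d), ‖((avgIter L U₀ i x κ : 𝔸ˣ) : 𝔸) - 1‖ ≤ ε)
    (w : Site d) : ‖((bgT L U₀ i (blockMap L w) w : 𝔸ˣ) : 𝔸) - 1‖ ≤ d * L * ε := by
  unfold bgT axialFn
  refine (norm_hol_sub_one_le hUi hεi _ _).trans ?_
  rw [length_treeWord]
  exact mul_le_mul_of_nonneg_right (by exact_mod_cast l1_sub_blockBase_blockMap_le hL w) hε0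

end PerLevel

/-! ## §2  The averaged backgrounds of a near-flat small-plaquette configuration -/

section Class

variable [Nontrivial 𝔸] {L : ℕ} (hL : 2 ≤ L) (k : ℕ) {U₀ : Site d → Fin d → 𝔸ˣ} (hU : ∀ (x : Site d) (κ : Fin d), U₀ x κ ∈ unitaryUnits 𝔸)
  {α₀ : ℝ} (hα : 0 < α₀) (hα3 : C0 d * α₀ ≤ 1 / 3) (hα2 : 2 * α₀ ≤ c2' d L) (h52 : pdev U₀ < α₀ * (((L : ℝ) ^ k)⁻¹) ^ 2)
  {δ : ℝ} (hδ0 : 0 ≤ δ) (hδ : ∀ (x : Site d) (κ : Fin d), ‖((U₀ x κ : 𝔸ˣ) : 𝔸) - 1‖ ≤ δ)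

include hL hU hα hα3 hα2 h52 in
/-- on the class (52) the averaged backgrounds stay unitary at every level `j ≤ k` (`AvgClosed` for the unitary group). [cite: Balaban1985Averaging, Prop. 2 (52)–(54) p.26, (42)–(43) pp.23–24] -/
theorem avgIter_mem_unitaryUnits_of_pdev : ∀ j, j ≤ k → ∀ (x : Site d) (κ : Fin d), avgIter L U₀ j x κ ∈ unitaryUnits 𝔸 :=
  avgIter_mem L hL (avgClosed_unitaryUnits d L) k U₀ hU hα hα3 hα2 h52

include hL hU hα hα3 hα2 h52 in
/-- hence the tower transporters are unitary at every level `j ≤ k`, for every pair of sites. [cite: Balaban1985Averaging, (78)–(80) p.30, Prop. 2 p.26] -/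
theorem bgT_mem_unitaryUnits_of_pdev {j : ℕ} (hj : j ≤ k) (y x : Site d) : bgT L U₀ j y x ∈ unitaryUnits 𝔸 :=
  bgT_pair_mem_of (avgIter_mem_unitaryUnits_of_pdev hL k hU hα hα3 hα2 h52 j hj) y x

include hL hU hα hα3 hα2 h52 hδ in
/-- ★★ **`‖Ūʲ(z,κ) − 1‖ ≤ 256(d+1)(d+4)·α₀·(Lʲ∕L^k)² + Lʲ·δ`** for `j ≤ k`: the area law of the NE9 chain (`Ūʲ` against the straight transporter of `Lʲ` fine bonds) and the
telescoping `‖U₀(seg) − 1‖ ≤ Lʲδ`. [cite: Balaban1985Averaging, (42)–(43) pp.23–24, Prop. 2 (52)–(54) p.26, p.25] -/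
theorem norm_avgIter_sub_one_le_of_straight {j : ℕ} (hj : j ≤ k) (z : Site d) (κ : Fin d) :
    ‖((avgIter L U₀ j z κ : 𝔸ˣ) : 𝔸) - 1‖ ≤ 256 * (d + 1) * (d + 4) * α₀ * ((L : ℝ) ^ j * ((L : ℝ) ^ k)⁻¹) ^ 2 + (L : ℝ) ^ j * δ := by
  have hU1 : ∀ (x : Site d) (κ' : Fin d), U₀ x κ' ∈ U1 𝔸 := fun x κ' => unitaryUnits_le_U1 (hU x κ')
  have h1 := norm_avgIter_sub_straight_le L hL (avgClosed_unitaryUnits d L) k U₀ hU hα hα3 hα2 h52 j hj z κ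
  have h2 : ‖((hol U₀ (((L : ℤ) ^ j) • z) (seg κ ((L ^ j : ℕ) : ℤ)) : 𝔸ˣ) : 𝔸) - 1‖ ≤ (L : ℝ) ^ j * δ := by
    refine (norm_hol_sub_one_le hU1 hδ _ _).trans ?_
    rw [length_seg]
    simp
  calc ‖((avgIter L U₀ j z κ : 𝔸ˣ) : 𝔸) - 1‖
      ≤ ‖((avgIter L U₀ j z κ : 𝔸ˣ) : 𝔸) - ((hol U₀ (((L : ℤ) ^ j) • z) (seg κ ((L ^ j : ℕ) : ℤ)) : 𝔸ˣ) : 𝔸)‖ +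
          ‖((hol U₀ (((L : ℤ) ^ j) • z) (seg κ ((L ^ j : ℕ) : ℤ)) : 𝔸ˣ) : 𝔸) - 1‖ := by
        rw [← sub_add_sub_cancel]
        exact norm_add_le _ _
    _ ≤ _ := add_le_add h1 h2

include hL hU hα hα3 hα2 h52 hδ0 hδ in
/-- ★★ **THE TOWER TRANSPORTERS OF A NEAR-FLAT SMALL-PLAQUETTE BACKGROUND**: `‖Ū₀ⁱ(Γ_{blockMap L w, w}) − 1‖ ≤ dL·(256(d+1)(d+4)α₀(Lⁱ∕L^k)² + Lⁱδ)` for `i ≤ k` — the displayed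
hypothesis `hTε` of `B9Thm31NearFlatCoerciveCubeZd.coercive_near_flat_cubeMember_of_norm` with `ε′_i` read off the background's own smallness.
[cite: Balaban1985Averaging, (78)–(80) p.30, (42)–(43) pp.23–24, Prop. 2 p.26; Balaban1985BackgroundPropagators, (3.19) p.393] -/
theorem norm_bgT_pair_sub_one_le {i : ℕ} (hi : i ≤ k) (w : Site d) :
    ‖((bgT L U₀ i (blockMap L w) w : 𝔸ˣ) : 𝔸) - 1‖ ≤
      d * L * (256 * (d + 1) * (d + 4) * α₀ * ((L : ℝ) ^ i * ((L : ℝ) ^ k)⁻¹) ^ 2 + (L : ℝ) ^ i * δ) := by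
  have hL1 : 1 ≤ L := le_trans (by norm_num) hL
  have hε0 : 0 ≤ 256 * (d + 1) * (d + 4) * α₀ * ((L : ℝ) ^ i * ((L : ℝ) ^ k)⁻¹) ^ 2 + (L : ℝ) ^ i * δ := by positivity
  exact norm_bgT_pair_sub_one_le_of_level hL1 hε0
    (fun x κ => unitaryUnits_le_U1 (avgIter_mem_unitaryUnits_of_pdev hL k hU hα hα3 hα2 h52 i hi x κ))
    (fun x κ => norm_avgIter_sub_one_le_of_straight hL k hU hα hα3 hα2 h52 hδ hi x κ) w

end Class

/-! ## §3  The scale-free weight bound `a_j(Lᵈ)^{−j}(Σ_{i<j}ε′_i)² ≤ κ′` -/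

section Weights

variable {L : ℕ}

/-- `Σ_{i<j} Lⁱ ≤ Lʲ` for `L ≥ 2`. [folklore] [cite: Balaban1985Averaging, (43) p.24 (bookkeeping)] -/
theorem sum_pow_lt_le (hL : 2 ≤ L) (j : ℕ) : ∑ i ∈ Finset.range j, (L : ℝ) ^ i ≤ (L : ℝ) ^ j := by
  have hLr : (2 : ℝ) ≤ L := by exact_mod_cast hL
  induction j with
  | zero => simp
  | succ j ih =>
    rw [Finset.sum_range_succ, pow_succ]
    nlinarith [ih, pow_nonneg (show (0 : ℝ) ≤ L by linarith) j]

/-- ★★ **THE SCALE-FREE `κ′`**: with `δ = θ′η`, `L^{−k} ≤ η`, `η·Lʲ ≤ 1` for `j ≤ m`, `θ′, α₀ ≥ 0`, and weights with `a_j·η²·(Lʲ)² ≤ A·(Lʲ)^d` (print's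
`a_j = aη⁻²L^{(d−2)j}`: `A = a`), the transporter bound of §2 gives, for every `j ≤ m`,
`a_j·(Lᵈ)^{−j}·(Σ_{i<j} dL(256(d+1)(d+4)α₀(Lⁱ∕L^k)² + Lⁱθ′η))² ≤ A·d²·L²·(256(d+1)(d+4)α₀ + θ′)²` — no `η`, `m`, `k` left.
[cite: Balaban1985Averaging, (43) p.24, Prop. 2 p.26; Balaban1985BackgroundPropagators, (3.23) p.394 («a_j(Lʲη)^{−2}» scaling)] -/
theorem sum_eps_sq_weight_le (hL : 2 ≤ L) {η : ℝ} (hη : 0 < η) {k m : ℕ} (hkη : ((L : ℝ) ^ k)⁻¹ ≤ η)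
    (hηL : ∀ j ∈ Finset.range (m + 1), η * (L : ℝ) ^ j ≤ 1) {θ' α₀ A : ℝ} (hθ' : 0 ≤ θ') (hα₀ : 0 ≤ α₀)
    {a : ℕ → ℝ} (ha : ∀ j, 0 ≤ a j) (haA : ∀ j ∈ Finset.range (m + 1), a j * η ^ 2 * ((L : ℝ) ^ j) ^ 2 ≤ A * ((L : ℝ) ^ j) ^ d)
    {j : ℕ} (hj : j ∈ Finset.range (m + 1)) :
    a j * ((((L : ℝ) ^ d) ^ j)⁻¹ *
        (∑ i ∈ Finset.range j, d * L * (256 * (d + 1) * (d + 4) * α₀ * ((L : ℝ) ^ i * ((L : ℝ) ^ k)⁻¹) ^ 2 + (L : ℝ) ^ i * (θ' * η))) ^ 2) ≤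
      A * d ^ 2 * (L : ℝ) ^ 2 * (256 * (d + 1) * (d + 4) * α₀ + θ') ^ 2 := by
  have hLr : (2 : ℝ) ≤ L := by exact_mod_cast hL
  have hL0 : (0 : ℝ) < L := by linarith
  have hjm : j ≤ m := Nat.lt_succ_iff.1 (Finset.mem_range.1 hj)
  set C₁ : ℝ := 256 * (d + 1) * (d + 4) * α₀ with hC₁
  have hC₁0 : 0 ≤ C₁ := by positivity
  set θ₂ : ℝ := C₁ + θ' with hθ₂
  -- each summand is at most `dL · Lⁱ η · θ₂`
  have hterm : ∀ i ∈ Finset.range j, d * L * (C₁ * ((L : ℝ) ^ i * ((L : ℝ) ^ k)⁻¹) ^ 2 + (L : ℝ) ^ i * (θ' * η)) ≤ d * L * η * θ₂ * (L : ℝ) ^ i := by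
    intro i hi
    have hij : i < j := Finset.mem_range.1 hi
    have him : i ∈ Finset.range (m + 1) := Finset.mem_range.2 (by omega)
    have hLi0 : 0 < (L : ℝ) ^ i := pow_pos hL0 i
    have hηLi : η * (L : ℝ) ^ i ≤ 1 := hηL i him
    -- `(Lⁱ/L^k)² ≤ (Lⁱ η)² ≤ Lⁱ η`
    have h1 : ((L : ℝ) ^ i * ((L : ℝ) ^ k)⁻¹) ^ 2 ≤ (L : ℝ) ^ i * η := by
      have hq : (L : ℝ) ^ i * ((L : ℝ) ^ k)⁻¹ ≤ (L : ℝ) ^ i * η := mul_le_mul_of_nonneg_left hkη hLi0.le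
      have hq0 : 0 ≤ (L : ℝ) ^ i * ((L : ℝ) ^ k)⁻¹ := by positivity
      calc ((L : ℝ) ^ i * ((L : ℝ) ^ k)⁻¹) ^ 2 ≤ ((L : ℝ) ^ i * η) ^ 2 := pow_le_pow_left₀ hq0 hq 2
        _ = ((L : ℝ) ^ i * η) * (η * (L : ℝ) ^ i) := by ring
        _ ≤ ((L : ℝ) ^ i * η) * 1 := mul_le_mul_of_nonneg_left hηLi (by positivity)
        _ = (L : ℝ) ^ i * η := mul_one _
    have hdL : 0 ≤ (d : ℝ) * L := by positivity
    calc d * L * (C₁ * ((L : ℝ) ^ i * ((L : ℝ) ^ k)⁻¹) ^ 2 + (L : ℝ) ^ i * (θ' * η))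
        ≤ d * L * (C₁ * ((L : ℝ) ^ i * η) + (L : ℝ) ^ i * (θ' * η)) :=
          mul_le_mul_of_nonneg_left (add_le_add (mul_le_mul_of_nonneg_left h1 hC₁0) le_rfl) hdL
      _ = d * L * η * θ₂ * (L : ℝ) ^ i := by rw [hθ₂]; ring
  have hsum : ∑ i ∈ Finset.range j, d * L * (C₁ * ((L : ℝ) ^ i * ((L : ℝ) ^ k)⁻¹) ^ 2 + (L : ℝ) ^ i * (θ' * η)) ≤ d * L * η * θ₂ * (L : ℝ) ^ j := by
    refine (Finset.sum_le_sum hterm).trans ?_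
    rw [← Finset.mul_sum]
    exact mul_le_mul_of_nonneg_left (sum_pow_lt_le hL j) (by positivity)
  have hsum0 : 0 ≤ ∑ i ∈ Finset.range j, d * L * (C₁ * ((L : ℝ) ^ i * ((L : ℝ) ^ k)⁻¹) ^ 2 + (L : ℝ) ^ i * (θ' * η)) :=
    Finset.sum_nonneg fun i _ => by positivity
  have hsq : (∑ i ∈ Finset.range j, d * L * (C₁ * ((L : ℝ) ^ i * ((L : ℝ) ^ k)⁻¹) ^ 2 + (L : ℝ) ^ i * (θ' * η))) ^ 2 ≤
      (d * L * η * θ₂ * (L : ℝ) ^ j) ^ 2 := pow_le_pow_left₀ hsum0 hsum 2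
  -- the weight: `a_j (Lᵈ)^{-j} (dLηθ₂Lʲ)² = a_j η² L^{2j} (Lᵈ)^{-j} · d²L²θ₂² ≤ A d² L² θ₂²`
  have hLdj : 0 < ((L : ℝ) ^ d) ^ j := by positivity
  have hw : a j * ((((L : ℝ) ^ d) ^ j)⁻¹ * (d * L * η * θ₂ * (L : ℝ) ^ j) ^ 2) ≤ A * d ^ 2 * (L : ℝ) ^ 2 * θ₂ ^ 2 := by
    have hre : a j * ((((L : ℝ) ^ d) ^ j)⁻¹ * (d * L * η * θ₂ * (L : ℝ) ^ j) ^ 2) =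
        (a j * η ^ 2 * ((L : ℝ) ^ j) ^ 2) * (((L : ℝ) ^ d) ^ j)⁻¹ * (d ^ 2 * (L : ℝ) ^ 2 * θ₂ ^ 2) := by ring
    rw [hre]
    have hpow : ((L : ℝ) ^ j) ^ d = ((L : ℝ) ^ d) ^ j := by rw [← pow_mul, ← pow_mul, mul_comm]
    have h2 : (a j * η ^ 2 * ((L : ℝ) ^ j) ^ 2) * (((L : ℝ) ^ d) ^ j)⁻¹ ≤ A := by
      rw [mul_inv_le_iff₀ hLdj, ← hpow]
      exact haA j hj
    calc (a j * η ^ 2 * ((L : ℝ) ^ j) ^ 2) * (((L : ℝ) ^ d) ^ j)⁻¹ * (d ^ 2 * (L : ℝ) ^ 2 * θ₂ ^ 2)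
        ≤ A * (d ^ 2 * (L : ℝ) ^ 2 * θ₂ ^ 2) := mul_le_mul_of_nonneg_right h2 (by positivity)
      _ = A * d ^ 2 * (L : ℝ) ^ 2 * θ₂ ^ 2 := by ring
  calc a j * ((((L : ℝ) ^ d) ^ j)⁻¹ * (∑ i ∈ Finset.range j, d * L * (C₁ * ((L : ℝ) ^ i * ((L : ℝ) ^ k)⁻¹) ^ 2 + (L : ℝ) ^ i * (θ' * η))) ^ 2)
      ≤ a j * ((((L : ℝ) ^ d) ^ j)⁻¹ * (d * L * η * θ₂ * (L : ℝ) ^ j) ^ 2) :=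
        mul_le_mul_of_nonneg_left (mul_le_mul_of_nonneg_left hsq (inv_nonneg.2 hLdj.le)) (ha j)
    _ ≤ A * d ^ 2 * (L : ℝ) ^ 2 * θ₂ ^ 2 := hw

end Weights

end Literature.MathematicalPhysics.QuantumFieldTheory.Balaban1983to89.B9Thm31NearFlatTransportersZd

end
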